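import Literature.Algebra.Polynomial.CasasAlvero.CharPCounterexample
import HarnessLib

/-!
# Casas-Alvero FAILS in every degree p^k + 1 (k ≥ 1) in characteristic p

The proof of Graf von Bothmer–Labs–Schicho–van de Woestijne's Prop. 7 (`CharPCounterexample.lean`, degree `p + 1`) uses about
`D^{(i)} (X^(p+1) - X^p)`, `0 < i < p`, only that both monomials keep a positive power of `X` (so `0` is a common root), and about
`D^{(p)}` only that `C(p+1, p) · 1 - 1 = p = 0`.  Both facts survive `p ↦ q = p^k`: `D^{(q)} (X^(q+1) - X^q) = (q+1) X - 1 = X - 1`.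
Hence `X^(q+1) - X^q = X^q (X - 1)` is a Casas-Alvero polynomial of degree `q + 1` over every field of characteristic `p`, for every
prime power `q = p^k > 1`, and `¬ HoldsInDegree K (p^k + 1)`: e.g. CA fails in degree 5 in characteristic 2, in degree 10 in
characteristic 3, in degree 26 in characteristic 5.  (Prop. 7 is the case `k = 1`.) [cite: GrafVonBothmerEtAl2007, Prop. 7]
-/

noncomputable section

open Polynomial

namespace Literature.Algebra.Polynomial.CasasAlvero

variable (K : Type*) [Field K] (p : ℕ) [Fact p.Prime] [CharP K p]

omit [Fact p.Prime] [CharP K p] in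
/-- `X^(q+1) - X^q` has degree `q + 1`. [folklore] -/
theorem natDegree_X_pow_succ_sub (q : ℕ) : ((X : K[X]) ^ (q + 1) - X ^ q).natDegree = q + 1 := by
  rw [natDegree_sub_eq_left_of_natDegree_lt] <;> simp

omit [Fact p.Prime] [CharP K p] in
/-- `X^(q+1) - X^q` is monic. [folklore] -/
theorem monic_X_pow_succ_sub (q : ℕ) : ((X : K[X]) ^ (q + 1) - X ^ q).Monic := by
  apply Monic.sub_of_left (monic_X_pow _)
  rw [degree_X_pow, degree_X_pow]
  exact_mod_cast Nat.lt_succ_self q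

/-- `X^(p^k+1) - X^(p^k)` is Casas-Alvero over every field of characteristic `p` (`k ≥ 1`).
[cite: GrafVonBothmerEtAl2007, Prop. 7] -/
theorem isCasasAlvero_X_pow_prime_pow_succ_sub {k : ℕ} (hk : k ≠ 0) :
    IsCasasAlvero ((X : K[X]) ^ (p ^ k + 1) - X ^ (p ^ k)) := by
  have hp : p.Prime := Fact.out
  have hq : 1 < p ^ k := Nat.one_lt_pow hk hp.one_lt
  intro i hi0 hi
  rw [natDegree_X_pow_succ_sub] at hi
  rcases Nat.lt_succ_iff_lt_or_eq.mp hi with h | h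
  · -- 0 < i < q : common root 0
    refine ⟨0, ?_, ?_⟩
    · simp only [eval_sub, eval_pow, eval_X]
      rw [zero_pow (by omega), zero_pow (by omega), sub_zero]
    · simp only [map_sub, hasseDeriv_X_pow, eval_sub, eval_mul, eval_C, eval_pow, eval_X]
      rw [zero_pow (by omega), zero_pow (by omega), mul_zero, mul_zero, sub_zero]
  · -- i = q : common root 1
    subst h
    refine ⟨1, ?_, ?_⟩
    · simp
    · simp only [map_sub, hasseDeriv_X_pow, eval_sub, eval_mul, eval_C, eval_pow, eval_X, one_pow,
        mul_one, Nat.choose_self, Nat.choose_succ_self_right, Nat.cast_succ, Nat.cast_pow, CharP.cast_eq_zero K p,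
        zero_pow hk, Nat.cast_zero, zero_add, sub_self]

/-- CA FAILS in degree `p^k + 1` (`k ≥ 1`) over every field of characteristic `p`. [cite: GrafVonBothmerEtAl2007, Prop. 7] -/
theorem not_holdsInDegree_prime_pow_succ {k : ℕ} (hk : k ≠ 0) : ¬ HoldsInDegree K (p ^ k + 1) := by
  have hp : p.Prime := Fact.out
  have hq0 : p ^ k ≠ 0 := pow_ne_zero k hp.ne_zero
  intro h
  obtain ⟨a, ha⟩ := h _ (monic_X_pow_succ_sub K (p ^ k)) (natDegree_X_pow_succ_sub K (p ^ k))
    (isCasasAlvero_X_pow_prime_pow_succ_sub K p hk)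
  have h0 := congrArg (eval 0) ha
  simp only [eval_sub, eval_pow, eval_X, zero_pow hq0, zero_pow (Nat.succ_ne_zero _), sub_zero, eval_C,
    zero_sub] at h0
  have ha0 : a = 0 := by
    have := (pow_eq_zero_iff (Nat.succ_ne_zero _)).mp h0.symm
    exact neg_eq_zero.mp this
  rw [ha0, map_zero, sub_zero, sub_eq_self] at ha
  exact pow_ne_zero _ X_ne_zero ha

/-- In particular CA fails in degree 5 in characteristic 2 (`5 = 2^2 + 1`). [cite: GrafVonBothmerEtAl2007, Prop. 7] -/
theorem not_holdsInDegree_five_of_char_two (L : Type*) [Field L] [CharP L 2] : ¬ HoldsInDegree L 5 :=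
  not_holdsInDegree_prime_pow_succ L 2 (k := 2) two_ne_zero

end Literature.Algebra.Polynomial.CasasAlvero
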